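import Summits.CriticalPhenomena.PercolationContinuityZ3.Theorems.PercNonProliferationSubpolynomialBlockingStubProductFloor
import Summits.CriticalPhenomena.PercolationContinuityZ3.Theorems.PercNonProliferationSubpolynomialBlockingStubOutArmLeSiteToBoundary
import Summits.CriticalPhenomena.PercolationContinuityZ3.Theorems.PercNonProliferationSubpolynomialBlockingStubInArmLeHalfSpaceReach
import Summits.CriticalPhenomena.PercolationContinuityZ3.Theorems.PercNonProliferationSubpolynomialBlockingStubFloorOfArmRates
import Summits.CriticalPhenomena.PercolationContinuityZ3.Theorems.PercNonProliferationSubpolynomialBlockingCritCrossingPos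
import Literature.NumberTheory.LFunctions.RobinOscillation
import HarnessLib

/-!
# `SubpolynomialBlocking`, line `SketchIdeator5` (two-sided charging) — corollaries of the product floor

Support file for crux item stmt-CriticalPhenomena-4446 (`PercNonProliferation.SubpolynomialBlocking`), lead a1.
With the landed stubs `stub_productFloor` (p128649), `stub_outArm_le_siteToBoundary` (p128630),
`stub_inArm_le_halfSpaceReach` (p128568), `stub_floorOfArmRates` (p128825, for `FloorOfArmRates.card_midSphere_le_real`:
`|∂ⁱⁿΛ_{n+⌊n/2⌋}| ≤ 96 n²`) and the tree's `blockProb_le_one_sub` (p118164: `u_n(p_c) ≤ 1 - c₀`):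

* `TwoSidedCharging.one_sub_charge_le` — `1 - Σ_v h_v g_v ≤ u_n(p)` (Weierstrass' product inequality, tree's
  `RobinOscillation.one_sub_sum_le_prod`, on the product floor), every `p`, `n ≥ 1`; hence
* `critCharge_ge` — **the critical two-sided charge is bounded below**: `∃ c > 0, ∀ n ≥ 1, c ≤ charge_{p_c}(n)`,
  `charge_p(n) = Σ_{v ∈ ∂ⁱⁿΛ_m} P_p(inArm v n) P_p(outArm v n)`, `m = n + ⌊n/2⌋` — the rigorous shadow of
  `x_s + x_b ≤ 2` (MEMO-ideator5-r2 §2), and the quantity the line's residual stub `stub_chargeSubLog` claims is `o(log n)`;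
* `TwoSidedCharging.inArm_le_siteToBoundary` — the inward arm is also a BULK arm of radius `⌊n/2⌋` (first exit),
  so `charge_p(n) ≤ |∂ⁱⁿΛ_m| · π_p(⌊n/2⌋)²` (`charge_le_card_mul_sq`, `π_p(k) = P_p(0 ↔ ∂ⁱⁿΛ_k)`), whence
* `critOneArm_ge_div` — **`π_{p_c(ℤ³)}(n) ≥ c / n`** for all `n ≥ 1`: the classical mid-sphere two-arm count
  (van den Berg–Kesten 1985 / Hammersley), two powers above the tree's `real_siteToBoundary_ge` (`c/(2n+1)³`);
* `critHalfSpaceReach_mul_oneArm_ge` — the MIXED inequality `c / n² ≤ h'_{⌊n/2⌋} · π(n - ⌊n/2⌋)` at `p_c(ℤ³)`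
  (`h'_t = P(halfSpaceReach 3 t)`), and its exponent form `armRate_exponents_sum_le_two`: a half-space reach rate
  `n^{-a}` and a one-arm rate `n^{-b}` at `p_c(ℤ³)` force `a + b ≤ 2` — the converse of the line's typed ceiling
  `stub_floorOfArmRates` (`exp(-C n^{2-a-b}) ≤ u_n`).
-/

noncomputable section

namespace Summit.CriticalPhenomena.PercolationContinuityZ3.Theorems.SubpolynomialBlocking

open MeasureTheory Filter Topology
open Literature.Probability.Percolation Literature.Probability.LatticeModels
open Literature.Probability.Percolation.DCT16
open Literature.Probability.Percolation.CerfDembinVanishing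
open Literature.Barriers.CriticalPhenomena
open Summit.CriticalPhenomena.PercolationContinuityZ3.Theorems.SubpolynomialBlocking.Negative

namespace TwoSidedCharging

/-! ## §1 Weierstrass on the product floor -/

/-- **`1 - charge ≤ u_n`** (every `p`, `n ≥ 1`): Weierstrass applied to `stub_productFloor`. -/
theorem one_sub_charge_le (p : unitInterval) {n : ℕ} (hn : 1 ≤ n) :
    1 - ∑ v ∈ innerBoundary (zdGraph 3) (box 3 (n + n / 2)),
        (bondPercolation (zdGraph 3) p).real
            {ω | ∃ x ∈ box 3 n, ω ∈ openConnIn (↑(box 3 (n + n / 2)) : Set (Site 3)) v x} *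
          (bondPercolation (zdGraph 3) p).real
            {ω | ∃ y ∈ innerBoundary (zdGraph 3) (box 3 (2 * n)),
              ω ∈ openConnIn (↑(box 3 (2 * n)) : Set (Site 3)) v y} ≤
      blockProb 3 p n := by
  refine le_trans ?_ (stub_productFloor p n hn)
  refine Literature.NumberTheory.LFunctions.RobinOscillation.one_sub_sum_le_prod _ _
    (fun v _ => mul_nonneg measureReal_nonneg measureReal_nonneg) fun v _ => ?_
  exact mul_le_one₀ measureReal_le_one measureReal_nonneg measureReal_le_one

/-! ## §2 The inward arm is also a bulk arm -/

/-- Geometry: if `x ∈ Λ_n` and `v ∈ ∂ⁱⁿΛ_{n + ⌊n/2⌋}` then `x - v ∉ Λ_{⌊n/2⌋}` or `x - v ∈ ∂ⁱⁿΛ_{⌊n/2⌋}`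
(a coordinate `j` with `v_j = ±(n + ⌊n/2⌋)` has `|x_j - v_j| ≥ ⌊n/2⌋`). -/
theorem sub_notMem_or_mem_innerBoundary_in {n : ℕ} {v x : Site 3}
    (hv : v ∈ innerBoundary (zdGraph 3) (box 3 (n + n / 2))) (hx : x ∈ box 3 n) :
    x - v ∉ box 3 (n / 2) ∨ x - v ∈ innerBoundary (zdGraph 3) (box 3 (n / 2)) := by
  by_cases h : x - v ∈ box 3 (n / 2)
  · refine Or.inr ?_
    obtain ⟨i, hi⟩ := exists_eq_of_mem_innerBoundary_box hv
    refine mem_innerBoundary_box_of_natAbs_eq h (i := i) ?_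
    have hxi := (mem_box.1 hx) i
    have hki := (mem_box.1 h) i
    simp only [Pi.sub_apply] at hki ⊢
    push_cast at hxi hki hi
    omega
  · exact Or.inl h

/-- **The inward arm is a one-arm event of radius `⌊n/2⌋`**: for `v ∈ ∂ⁱⁿΛ_{n+⌊n/2⌋}`,
`P_p(∃ x ∈ Λ_n, v ↔ x in Λ_{n+⌊n/2⌋}) ≤ P_p(0 ↔ ∂ⁱⁿΛ_{⌊n/2⌋})` (first exit from `v + Λ_{⌊n/2⌋}`,
`DCT16.armEvent_of_pathIn`; translation invariance `DCT16.real_armEvent`). -/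
theorem inArm_le_siteToBoundary (p : unitInterval) {n : ℕ} {v : Site 3}
    (hv : v ∈ innerBoundary (zdGraph 3) (box 3 (n + n / 2))) :
    (bondPercolation (zdGraph 3) p).real
        {ω | ∃ x ∈ box 3 n, ω ∈ openConnIn (↑(box 3 (n + n / 2)) : Set (Site 3)) v x} ≤
      (bondPercolation (zdGraph 3) p).real (siteToBoundary 3 (n / 2)) := by
  rw [← DCT16.real_armEvent p v (n / 2)]
  refine DCT16.real_mono_of_forall_subset_edgeSet (zdGraph 3) p fun ω hω h => ?_
  obtain ⟨x, hx, hpath⟩ := h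
  exact DCT16.armEvent_of_pathIn hω (DCT16.mem_openConnIn_iff_pathIn.1 hpath)
    (sub_notMem_or_mem_innerBoundary_in hv hx)

/-- **`charge_p(n) ≤ |∂ⁱⁿΛ_m| · π_p(⌊n/2⌋)²`** (every `p`, `n`): both arms of a mid-sphere site are one-arm events of
radius `≥ ⌊n/2⌋` (`inArm_le_siteToBoundary`; `stub_outArm_le_siteToBoundary` + `real_siteToBoundary_antitone`,
`⌊n/2⌋ ≤ n - ⌊n/2⌋`). -/
theorem charge_le_card_mul_sq (p : unitInterval) {n : ℕ} (hn : 1 ≤ n) :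
    ∑ v ∈ innerBoundary (zdGraph 3) (box 3 (n + n / 2)),
        (bondPercolation (zdGraph 3) p).real
            {ω | ∃ x ∈ box 3 n, ω ∈ openConnIn (↑(box 3 (n + n / 2)) : Set (Site 3)) v x} *
          (bondPercolation (zdGraph 3) p).real
            {ω | ∃ y ∈ innerBoundary (zdGraph 3) (box 3 (2 * n)),
              ω ∈ openConnIn (↑(box 3 (2 * n)) : Set (Site 3)) v y} ≤
      ((innerBoundary (zdGraph 3) (box 3 (n + n / 2))).card : ℝ) *
        (bondPercolation (zdGraph 3) p).real (siteToBoundary 3 (n / 2)) ^ 2 := by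
  have hanti : (bondPercolation (zdGraph 3) p).real (siteToBoundary 3 (n - n / 2)) ≤
      (bondPercolation (zdGraph 3) p).real (siteToBoundary 3 (n / 2)) :=
    real_siteToBoundary_antitone p (by omega)
  calc ∑ v ∈ innerBoundary (zdGraph 3) (box 3 (n + n / 2)),
        (bondPercolation (zdGraph 3) p).real
            {ω | ∃ x ∈ box 3 n, ω ∈ openConnIn (↑(box 3 (n + n / 2)) : Set (Site 3)) v x} *
          (bondPercolation (zdGraph 3) p).real
            {ω | ∃ y ∈ innerBoundary (zdGraph 3) (box 3 (2 * n)),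
              ω ∈ openConnIn (↑(box 3 (2 * n)) : Set (Site 3)) v y}
      ≤ ∑ _v ∈ innerBoundary (zdGraph 3) (box 3 (n + n / 2)),
          (bondPercolation (zdGraph 3) p).real (siteToBoundary 3 (n / 2)) ^ 2 := by
        refine Finset.sum_le_sum fun v hv => ?_
        rw [sq]
        exact mul_le_mul (inArm_le_siteToBoundary p hv)
          ((stub_outArm_le_siteToBoundary p n v hn hv).trans hanti) measureReal_nonneg measureReal_nonneg
    _ = _ := by rw [Finset.sum_const, nsmul_eq_mul]

/-- **`charge_{p_c}(n) ≤ |∂ⁱⁿΛ_m| · h'_{⌊n/2⌋} · π(n - ⌊n/2⌋)`** (the two transfers of the line, `stub_inArm_le_halfSpaceReach`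
and `stub_outArm_le_siteToBoundary`), every `p`. -/
theorem charge_le_card_mul_halfSpaceReach_mul (p : unitInterval) {n : ℕ} (hn : 1 ≤ n) :
    ∑ v ∈ innerBoundary (zdGraph 3) (box 3 (n + n / 2)),
        (bondPercolation (zdGraph 3) p).real
            {ω | ∃ x ∈ box 3 n, ω ∈ openConnIn (↑(box 3 (n + n / 2)) : Set (Site 3)) v x} *
          (bondPercolation (zdGraph 3) p).real
            {ω | ∃ y ∈ innerBoundary (zdGraph 3) (box 3 (2 * n)),
              ω ∈ openConnIn (↑(box 3 (2 * n)) : Set (Site 3)) v y} ≤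
      ((innerBoundary (zdGraph 3) (box 3 (n + n / 2))).card : ℝ) *
        ((bondPercolation (zdGraph 3) p).real (halfSpaceReach 3 (n / 2)) *
          (bondPercolation (zdGraph 3) p).real (siteToBoundary 3 (n - n / 2))) := by
  calc ∑ v ∈ innerBoundary (zdGraph 3) (box 3 (n + n / 2)),
        (bondPercolation (zdGraph 3) p).real
            {ω | ∃ x ∈ box 3 n, ω ∈ openConnIn (↑(box 3 (n + n / 2)) : Set (Site 3)) v x} *
          (bondPercolation (zdGraph 3) p).real
            {ω | ∃ y ∈ innerBoundary (zdGraph 3) (box 3 (2 * n)),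
              ω ∈ openConnIn (↑(box 3 (2 * n)) : Set (Site 3)) v y}
      ≤ ∑ _v ∈ innerBoundary (zdGraph 3) (box 3 (n + n / 2)),
          ((bondPercolation (zdGraph 3) p).real (halfSpaceReach 3 (n / 2)) *
            (bondPercolation (zdGraph 3) p).real (siteToBoundary 3 (n - n / 2))) := by
        refine Finset.sum_le_sum fun v hv => ?_
        exact mul_le_mul (stub_inArm_le_halfSpaceReach p n v hv)
          (stub_outArm_le_siteToBoundary p n v hn hv) measureReal_nonneg measureReal_nonneg
    _ = _ := by rw [Finset.sum_const, nsmul_eq_mul]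

end TwoSidedCharging

/-! ## §3 The critical consequences -/

/-- **THE CRITICAL TWO-SIDED CHARGE IS BOUNDED BELOW** (line `SketchIdeator5`, crux stmt-CriticalPhenomena-4446):
there is `c > 0` with `c ≤ Σ_{v ∈ ∂ⁱⁿΛ_m} P_{p_c}(inArm v n) · P_{p_c}(outArm v n)` for all `n ≥ 1` (`m = n + ⌊n/2⌋`).
From `1 - charge ≤ u_n ≤ 1 - c` (`TwoSidedCharging.one_sub_charge_le`, `blockProb_le_one_sub`). Heuristically the
charge is `≍ n^{2 - x_s - x_b}`; this is the rigorous `x_s + x_b ≤ 2` (MEMO-ideator5-r2 §2). The line's residual stub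
`stub_chargeSubLog` asserts the charge is `o(log n)` — compatible with this floor, contradicted only numerically. -/
theorem critCharge_ge :
    ∃ c : ℝ, 0 < c ∧ ∀ n : ℕ, 1 ≤ n →
      c ≤ ∑ v ∈ innerBoundary (zdGraph 3) (box 3 (n + n / 2)),
        (bondPercolation (zdGraph 3) (criticalProbI 3)).real
            {ω | ∃ x ∈ box 3 n, ω ∈ openConnIn (↑(box 3 (n + n / 2)) : Set (Site 3)) v x} *
          (bondPercolation (zdGraph 3) (criticalProbI 3)).real
            {ω | ∃ y ∈ innerBoundary (zdGraph 3) (box 3 (2 * n)),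
              ω ∈ openConnIn (↑(box 3 (2 * n)) : Set (Site 3)) v y} := by
  obtain ⟨c, hc, h⟩ := blockProb_le_one_sub 3 (by norm_num)
  refine ⟨c, hc, fun n hn => ?_⟩
  have h1 := TwoSidedCharging.one_sub_charge_le (criticalProbI 3) hn
  have h2 := h n hn
  linarith

/-- **CRITICAL ONE-ARM LOWER BOUND ON `ℤ³`: `π_{p_c}(n) ≥ c / n`** for all `n ≥ 1` — the classical mid-sphere two-arm
count (van den Berg–Kesten 1985; Grimmett 1999 §2 exercises): `c₀ ≤ charge(2n) ≤ |∂ⁱⁿΛ_{3n}| π(n)² ≤ 96 (2n)² π(n)²`.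
Improves the tree's `real_siteToBoundary_ge` (`c/(2n+1)³`, p118164) by two powers of `n`. -/
theorem critOneArm_ge_div :
    ∃ c : ℝ, 0 < c ∧ ∀ n : ℕ, 1 ≤ n →
      c / n ≤ (bondPercolation (zdGraph 3) (criticalProbI 3)).real (siteToBoundary 3 n) := by
  obtain ⟨c₀, hc₀, h⟩ := critCharge_ge
  refine ⟨Real.sqrt (c₀ / 384), by positivity, fun n hn => ?_⟩
  have hπ0 : 0 ≤ (bondPercolation (zdGraph 3) (criticalProbI 3)).real (siteToBoundary 3 n) := measureReal_nonneg
  have hn0 : (0 : ℝ) < n := by exact_mod_cast hn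
  have h2n : 1 ≤ 2 * n := by omega
  have hdiv : 2 * n / 2 = n := by omega
  have h1 := h (2 * n) h2n
  have h2 := TwoSidedCharging.charge_le_card_mul_sq (criticalProbI 3) (n := 2 * n) h2n
  have h3 := FloorOfArmRates.card_midSphere_le_real (n := 2 * n) h2n
  rw [hdiv] at h1 h2 h3
  -- `c₀ ≤ charge(2n) ≤ card · π(n)² ≤ 96 (2n)² π(n)²`
  have key : c₀ ≤ 96 * ((2 * n : ℕ) : ℝ) ^ 2 *
      (bondPercolation (zdGraph 3) (criticalProbI 3)).real (siteToBoundary 3 n) ^ 2 :=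
    h1.trans (h2.trans (mul_le_mul_of_nonneg_right h3 (sq_nonneg _)))
  have hsq : c₀ / 384 ≤ ((n : ℝ) * (bondPercolation (zdGraph 3) (criticalProbI 3)).real (siteToBoundary 3 n)) ^ 2 := by
    have hring : 96 * ((2 * n : ℕ) : ℝ) ^ 2 *
        (bondPercolation (zdGraph 3) (criticalProbI 3)).real (siteToBoundary 3 n) ^ 2 =
          384 * ((n : ℝ) * (bondPercolation (zdGraph 3) (criticalProbI 3)).real (siteToBoundary 3 n)) ^ 2 := by
      push_cast; ring
    rw [div_le_iff₀ (by norm_num : (0 : ℝ) < 384)]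
    linarith
  have hsqrt : Real.sqrt (c₀ / 384) ≤ (n : ℝ) * (bondPercolation (zdGraph 3) (criticalProbI 3)).real (siteToBoundary 3 n) := by
    rw [← Real.sqrt_sq (mul_nonneg hn0.le hπ0)]
    exact Real.sqrt_le_sqrt hsq
  rw [div_le_iff₀ hn0]
  linarith

/-- **THE MIXED ARM INEQUALITY AT `p_c(ℤ³)`**: there is `c > 0` with
`c / n² ≤ P_{p_c}(halfSpaceReach 3 ⌊n/2⌋) · P_{p_c}(0 ↔ ∂ⁱⁿΛ_{n - ⌊n/2⌋})` for all `n ≥ 1` — the half-space one-arm and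
the bulk one-arm cannot BOTH be small: `c₀ ≤ charge(n) ≤ 96 n² · h'_{⌊n/2⌋} · π(n - ⌊n/2⌋)`. -/
theorem critHalfSpaceReach_mul_oneArm_ge :
    ∃ c : ℝ, 0 < c ∧ ∀ n : ℕ, 1 ≤ n →
      c / (n : ℝ) ^ 2 ≤ (bondPercolation (zdGraph 3) (criticalProbI 3)).real (halfSpaceReach 3 (n / 2)) *
        (bondPercolation (zdGraph 3) (criticalProbI 3)).real (siteToBoundary 3 (n - n / 2)) := by
  obtain ⟨c₀, hc₀, h⟩ := critCharge_ge
  refine ⟨c₀ / 96, by positivity, fun n hn => ?_⟩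
  have hn0 : (0 : ℝ) < n := by exact_mod_cast hn
  have h1 := h n hn
  have h2 := TwoSidedCharging.charge_le_card_mul_halfSpaceReach_mul (criticalProbI 3) hn
  have h3 := FloorOfArmRates.card_midSphere_le_real hn
  have hHG : 0 ≤ (bondPercolation (zdGraph 3) (criticalProbI 3)).real (halfSpaceReach 3 (n / 2)) *
      (bondPercolation (zdGraph 3) (criticalProbI 3)).real (siteToBoundary 3 (n - n / 2)) :=
    mul_nonneg measureReal_nonneg measureReal_nonneg
  have key : c₀ ≤ 96 * (n : ℝ) ^ 2 * ((bondPercolation (zdGraph 3) (criticalProbI 3)).real (halfSpaceReach 3 (n / 2)) *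
      (bondPercolation (zdGraph 3) (criticalProbI 3)).real (siteToBoundary 3 (n - n / 2))) :=
    h1.trans (h2.trans (mul_le_mul_of_nonneg_right h3 hHG))
  rw [div_le_iff₀ (by positivity)]
  linarith

/-- **Arm-rate exponents at `p_c(ℤ³)` sum to at most `2`**: if `P_{p_c}(halfSpaceReach 3 n) ≤ C₁ n^{-a}` and
`P_{p_c}(0 ↔ ∂ⁱⁿΛ_n) ≤ C₂ n^{-b}` for all `n ≥ 1`, then `a + b ≤ 2`. This is the converse side of the line's typed ceiling
(`stub_floorOfArmRates`: such rates give `exp(-C n^{2-a-b}) ≤ u_n`, which is polynomial iff `a + b ≥ 2`): the charging class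
can never certify a polynomial blocking floor from true arm rates unless `a + b = 2` exactly. -/
theorem armRate_exponents_sum_le_two {a b C₁ C₂ : ℝ}
    (ha : ∀ n : ℕ, 1 ≤ n → (bondPercolation (zdGraph 3) (criticalProbI 3)).real (halfSpaceReach 3 n) ≤ C₁ * (n : ℝ) ^ (-a))
    (hb : ∀ n : ℕ, 1 ≤ n → (bondPercolation (zdGraph 3) (criticalProbI 3)).real (siteToBoundary 3 n) ≤ C₂ * (n : ℝ) ^ (-b)) :
    a + b ≤ 2 := by
  by_contra hab
  rw [not_le] at hab
  obtain ⟨c, hc, h⟩ := critHalfSpaceReach_mul_oneArm_ge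
  -- along even `n = 2k`, `k ≥ 1`: `c/(2k)² ≤ h'_k π_k ≤ C₁ C₂ k^{-(a+b)}`, i.e. `c/4 ≤ C₁ C₂ k^{2-(a+b)} → 0`
  have hC : ∀ k : ℕ, 1 ≤ k → c / 4 ≤ C₁ * C₂ * (k : ℝ) ^ (2 - (a + b)) := by
    intro k hk
    have hk0 : (0 : ℝ) < k := by exact_mod_cast hk
    have h1 := h (2 * k) (by omega)
    have hdiv : 2 * k / 2 = k := by omega
    have hsub : 2 * k - k = k := by omega
    rw [hdiv, hsub] at h1
    have hH0 : 0 ≤ (bondPercolation (zdGraph 3) (criticalProbI 3)).real (halfSpaceReach 3 k) := measureReal_nonneg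
    have hG0 : 0 ≤ (bondPercolation (zdGraph 3) (criticalProbI 3)).real (siteToBoundary 3 k) := measureReal_nonneg
    have h2 : (bondPercolation (zdGraph 3) (criticalProbI 3)).real (halfSpaceReach 3 k) *
        (bondPercolation (zdGraph 3) (criticalProbI 3)).real (siteToBoundary 3 k) ≤
          (C₁ * (k : ℝ) ^ (-a)) * (C₂ * (k : ℝ) ^ (-b)) :=
      mul_le_mul (ha k hk) (hb k hk) hG0 ((hH0.trans (ha k hk)))
    have h3 : (C₁ * (k : ℝ) ^ (-a)) * (C₂ * (k : ℝ) ^ (-b)) = C₁ * C₂ * (k : ℝ) ^ (2 - (a + b)) / (k : ℝ) ^ 2 := by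
      rw [eq_div_iff (by positivity), show (2 : ℝ) - (a + b) = (-a) + (-b) + 2 by ring,
        Real.rpow_add hk0, Real.rpow_add hk0, Real.rpow_two]
      ring
    have h4 : c / ((2 * k : ℕ) : ℝ) ^ 2 = (c / 4) / (k : ℝ) ^ 2 := by
      push_cast; field_simp; ring
    rw [h4] at h1
    have h5 := h1.trans (h2.trans_eq h3)
    rwa [div_le_div_iff_of_pos_right (by positivity)] at h5
  -- but `k^{2-(a+b)} → 0`
  have hlim0 : Tendsto (fun k : ℕ => (k : ℝ) ^ (2 - (a + b))) atTop (𝓝 0) := by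
    have h0 := (tendsto_rpow_neg_atTop (by linarith : 0 < (a + b) - 2)).comp tendsto_natCast_atTop_atTop
    refine h0.congr fun k => ?_
    simp only [Function.comp_apply]
    congr 1
    ring
  have hlim : Tendsto (fun k : ℕ => C₁ * C₂ * (k : ℝ) ^ (2 - (a + b))) atTop (𝓝 (C₁ * C₂ * 0)) :=
    hlim0.const_mul (C₁ * C₂)
  rw [mul_zero] at hlim
  have hev := hlim.eventually (gt_mem_nhds (show (0 : ℝ) < c / 4 by positivity))
  obtain ⟨k, hk1, hk2⟩ := (hev.and (eventually_ge_atTop 1)).exists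
  exact absurd (hC k hk2) (not_le.2 hk1)

end Summit.CriticalPhenomena.PercolationContinuityZ3.Theorems.SubpolynomialBlocking

end
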